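import Summits.ValiantsHypothesis.ValiantsHypothesis.Theorems.DivisionGapPerDivisionHardStubDescentAt
import Summits.ValiantsHypothesis.ValiantsHypothesis.Theorems.DivisionGapPerDivisionHardStubFibreArith
import Summits.ValiantsHypothesis.ValiantsHypothesis.Theorems.DivisionGapPerDivisionHardStubJssContraction
import Summits.ValiantsHypothesis.ValiantsHypothesis.Theorems.DivisionGapPerDivisionHardSparseGraph
import Summits.ValiantsHypothesis.ValiantsHypothesis.Theorems.PerDivisionHard.Negative.PerLowDegreeRung

/-!
# Crux `DivisionGap.PerDivisionHard` (stmt-ValiantsHypothesis-5065), line `pair-descent-jss-endpoint` —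
the GENERIC DESCENT TRANSFER and two of its instances (skeleton v9, lead seat c5)

The line degenerates a cheap monotone pair `(per_n · h, h)` over `ℝ≥0` to a placed block face
`G = placedBlock eR eC` (`G(b,k) ⊕ M₀`) of the Birkhoff polytope and projects it with the phase
projection to the pair `(per_b · h♭, h♭)`, `h♭ = aeval (blockSubst eR eC) (top_w h)`, at block size
`b`, which is at most as expensive (`stub_descentAt`, landed).  Hence every lower bound for the
crux's pairs at size `b` transfers to size `n` once the block is LARGE (`n ≤ b^a`, so that
quasi-polynomial in `b` is quasi-polynomial in `n`: `stub_fibreArith`, landed):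

* `perDivisionHard_projectedPair` — the transfer itself: if for some placement with `n ≤ b^a` and
  some weight cutting the face out the projected pair costs more than `2^{(log₂ b + c₁)^{c₁}}`,
  `c₁ = c₁(a, c)`, then `2^{(log₂ n + c)^c} < L(per_n · h) + L(h)`;
* `perDivisionHard_sparseGraphFibre` — instance with the landed sparse-graph rung
  `perDivisionHard_sparseGraph` at the bottom: some projected fibre has a sparse variable graph;
* `perDivisionHard_backgroundLowDegree` — instance with JSS contraction (`stub_jssContraction`)
  and the landed low-degree rung `Negative.two_pow_le_complexity_perPoly_mul` at the bottom: some
  projected fibre is a monomial background `X^U` times a nonzero `F` of low degree.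

All `--supports stmt-ValiantsHypothesis-5065`; the skeleton
`Cruxes/PerDivisionHard/Lines/pair_descent_jss_endpoint.lean` (v9) carries the same compositions
modulo its stubs.
-/

noncomputable section

-- `Summit.ValiantsHypothesis.ValiantsHypothesis.…` is the tree's mandated single-conjunct layout
-- (Sub = Summit), so the duplicated namespace component is intended.
set_option linter.dupNamespace false

namespace Summit.ValiantsHypothesis.ValiantsHypothesis.Theorems.DivisionGapPerDivisionHard

open MvPolynomial Literature.Computability.AlgebraicComplexity
open Summit.ValiantsHypothesis.ValiantsHypothesis.Theorems.ZeroOneTransfer.Negative (topComponent)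
open scoped NNReal

/-- **The generic descent transfer.**  If on SOME placed block face with `n ≤ b^a`, under SOME
weight cutting it out, the projected pair `(per_b · h♭, h♭)`, `h♭ = aeval (blockSubst eR eC) (top_w h)`,
is expensive at level `c₁ = c₁(a, c)` of size `b`, then the pair `(per_n · h, h)` is expensive at
level `c` of size `n` (`stub_descentAt` + `stub_fibreArith`).  Every rung of the crux proved at
size `b` plugs in here. [folklore] -/
theorem perDivisionHard_projectedPair :
    ∀ a c : ℕ, ∃ c₁ : ℕ, ∀ (n : ℕ) (h : MvPolynomial (Fin n × Fin n) ℝ≥0), h ≠ 0 →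
      (∃ (b k m : ℕ) (eR eC : BlockV b k m ≃ Fin n) (w : Fin n × Fin n → ℕ),
        CutsOut w (placedBlock eR eC) ∧ n ≤ b ^ a ∧
        2 ^ ((Nat.log 2 b + c₁) ^ c₁) <
          complexity (perPoly (Fin b) ℝ≥0 * aeval (blockSubst eR eC) (topComponent w h)) +
            complexity (aeval (blockSubst eR eC) (topComponent w h))) →
      2 ^ ((Nat.log 2 n + c) ^ c) < complexity (perPoly (Fin n) ℝ≥0 * h) + complexity h := by
  intro a c
  obtain ⟨c₁, hc₁⟩ := stub_fibreArith a c
  refine ⟨c₁, ?_⟩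
  rintro n h hh ⟨b, k, m, eR, eC, w, hcut, hnb, hlt⟩
  obtain ⟨-, hle1, hle2, -⟩ := stub_descentAt b k m n eR eC w h hcut hh
  calc 2 ^ ((Nat.log 2 n + c) ^ c) ≤ 2 ^ ((Nat.log 2 b + c₁) ^ c₁) :=
        Nat.pow_le_pow_right two_pos (hc₁ n b hnb)
    _ < _ := hlt
    _ ≤ complexity (perPoly (Fin n) ℝ≥0 * h) + complexity h := Nat.add_le_add hle1 hle2

/-- **The sparse-graph-fibre rung** (instance of the transfer; endpoint the landed
`perDivisionHard_sparseGraph` at size `b`): `PerDivisionHard`'s inequality for every nonzero `h`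
such that on SOME placed block face with `n ≤ b^a`, under SOME weight cutting it out, the
projected fibre `h♭` has a sparse variable graph — every row and every column of the `b × b` block
meets at most `b/(log₂ b + e)^e` of its variables (any number of monomials, any cost). [folklore] -/
theorem perDivisionHard_sparseGraphFibre :
    ∀ a c : ℕ, ∃ e n₀ : ℕ, ∀ n ≥ n₀, ∀ h : MvPolynomial (Fin n × Fin n) ℝ≥0, h ≠ 0 →
      (∃ (b k m : ℕ) (eR eC : BlockV b k m ≃ Fin n) (w : Fin n × Fin n → ℕ),
        CutsOut w (placedBlock eR eC) ∧ n ≤ b ^ a ∧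
        (∀ r : Fin b, (((aeval (blockSubst eR eC) (topComponent w h)).support.biUnion
            fun m => m.support).filter (fun x => x.1 = r)).card ≤ b / (Nat.log 2 b + e) ^ e) ∧
        (∀ s : Fin b, (((aeval (blockSubst eR eC) (topComponent w h)).support.biUnion
            fun m => m.support).filter (fun x => x.2 = s)).card ≤ b / (Nat.log 2 b + e) ^ e)) →
      2 ^ ((Nat.log 2 n + c) ^ c) < complexity (perPoly (Fin n) ℝ≥0 * h) + complexity h := by
  intro a c
  obtain ⟨c₁, hc₁⟩ := perDivisionHard_projectedPair a c
  obtain ⟨e, n₁, hG⟩ := perDivisionHard_sparseGraph c₁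
  refine ⟨e, n₁ ^ a + 2, ?_⟩
  rintro n hn h hh ⟨b, k, m, eR, eC, w, hcut, hnb, hrow, hcol⟩
  have ha : a ≠ 0 := by
    rintro rfl
    rw [pow_zero] at hnb
    omega
  have hb : n₁ ≤ b :=
    (Nat.pow_le_pow_iff_left ha).mp (le_trans (le_trans (Nat.le_add_right _ _) hn) hnb)
  obtain ⟨hne, -, -, -⟩ := stub_descentAt b k m n eR eC w h hcut hh
  exact hc₁ n h hh ⟨b, k, m, eR, eC, w, hcut, hnb, hG b hb _ hne hrow hcol⟩

/-- **The background-low-degree rung** (instance of the transfer; endpoints the landed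
`Negative.two_pow_le_complexity_perPoly_mul` and `stub_jssContraction`): the inequality for every
nonzero `h` such that on SOME placed block face with `n ≤ b^a`, under SOME weight cutting it out,
the projected fibre splits as `h♭ = X^U · F` with `F ≠ 0`, `deg F + 6 ≤ b` and
`((b+2)(2^{(log₂ b + c₁)^{c₁}} + 2))^κ + 1 < 2^{⌊(b − deg F)/3⌋}` — a heavy monomial background plus
a low-degree (possibly dense and rich) perturbation: `L(per_b · X^U · F) ≤ 2^{B_b}` by descent,
JSS contraction strips `X^U` at polynomial cost, and `per_b · F` alone costs `2^{(b − deg F)/3} − 1`.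
[folklore] -/
theorem perDivisionHard_backgroundLowDegree :
    ∀ a c : ℕ, ∃ κ c₁ : ℕ, ∀ (n : ℕ) (h : MvPolynomial (Fin n × Fin n) ℝ≥0), h ≠ 0 →
      (∃ (b k m : ℕ) (eR eC : BlockV b k m ≃ Fin n) (w : Fin n × Fin n → ℕ)
          (U : (Fin b × Fin b) →₀ ℕ) (F : MvPolynomial (Fin b × Fin b) ℝ≥0),
        CutsOut w (placedBlock eR eC) ∧ n ≤ b ^ a ∧
        aeval (blockSubst eR eC) (topComponent w h) = monomial U 1 * F ∧ F ≠ 0 ∧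
        F.totalDegree + 6 ≤ b ∧
        ((b + 2) * (2 ^ ((Nat.log 2 b + c₁) ^ c₁) + 2)) ^ κ + 1 < 2 ^ ((b - F.totalDegree) / 3)) →
      2 ^ ((Nat.log 2 n + c) ^ c) < complexity (perPoly (Fin n) ℝ≥0 * h) + complexity h := by
  classical
  intro a c
  obtain ⟨κ, hcon⟩ := stub_jssContraction
  obtain ⟨c₁, hc₁⟩ := stub_fibreArith a c
  refine ⟨κ, c₁, ?_⟩
  rintro n h hh ⟨b, k, m, eR, eC, w, U, F, hcut, hnb, hsplit, hF, hdeg, hgap⟩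
  by_contra hlt
  have hle : complexity (perPoly (Fin n) ℝ≥0 * h) + complexity h ≤
      2 ^ ((Nat.log 2 n + c) ^ c) := not_lt.mp hlt
  have hlev : 2 ^ ((Nat.log 2 n + c) ^ c) ≤ 2 ^ ((Nat.log 2 b + c₁) ^ c₁) :=
    Nat.pow_le_pow_right two_pos (hc₁ n b hnb)
  obtain ⟨-, hle1, -, -⟩ := stub_descentAt b k m n eR eC w h hcut hh
  rw [hsplit] at hle1
  have h1 : complexity (monomial U (1 : ℝ≥0) * (perPoly (Fin b) ℝ≥0 * F)) ≤
      2 ^ ((Nat.log 2 b + c₁) ^ c₁) := by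
    rw [mul_left_comm]
    exact hle1.trans ((Nat.le_add_right _ _).trans (hle.trans hlev))
  have h2 : complexity (perPoly (Fin b) ℝ≥0 * F) ≤
      ((b + 2) * (2 ^ ((Nat.log 2 b + c₁) ^ c₁) + 2)) ^ κ :=
    (hcon b (perPoly (Fin b) ℝ≥0 * F) U).trans
      (Nat.pow_le_pow_left (Nat.mul_le_mul_left _ (Nat.add_le_add_right h1 2)) κ)
  have h3 := Summit.ValiantsHypothesis.ValiantsHypothesis.Theorems.PerDivisionHard.Negative.two_pow_le_complexity_perPoly_mul hF hdeg
  omega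

end Summit.ValiantsHypothesis.ValiantsHypothesis.Theorems.DivisionGapPerDivisionHard

end
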